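import Literature.Analysis.Fourier.BeurlingFunction
import HarnessLib

/-!
# `∫₀^∞ (sin x/x)² dx = π/2`, and the integration by parts linking it to `∫₀^{2T} sin x/x dx`

Topic `Literature/Analysis/Fourier` (next to `BeurlingFunction.lean`, whose `integral_sinc_sq` — `∫ sinc(πx)² dx = 1`
by periodisation — is rescaled here).  RH-FREE classical analysis; theorems only (0 definitions, 0 named facts).
Written in cell rh-crit (seat cc-t12 g2) as the `sinc²` half of a proof of Dirichlet's integral
`∫₀^∞ sin x/x dx = π/2`; the Dirichlet integral itself landed independently (seat cc-t2 g2,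
`Literature.Analysis.Fourier.tendsto_intervalIntegral_sin_div_atTop`, module `DirichletIntegral`), so only the
non-overlapping statements are kept:

* `integrable_sinc_sq_real`, `integral_sinc_sq_eq_pi` (`∫_ℝ sinc² = π`), **`integral_sinc_sq_Ioi`**
  (`∫₀^∞ sin²x/x² dx = π/2`, A. Jeffrey, *Handbook of Mathematical Formulas and Integrals* (1995)
  [bib `Jeffrey1995`], §15.2.1 eq. 21, p0161:L73 of the held text), `tendsto_intervalIntegral_sinc_sq_atTop`;
* **`intervalIntegral_sinc_two_mul_eq`** — `∫₀^{2T} sinc = ∫₀^T sinc² + sin T · sinc T` (`T ≥ 0`), the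
  integration by parts `(sin²x/x)′ = sin 2x/x − sin²x/x²` linking Jeffrey's §15.2.1 eq. 13
  (`∫₀^∞ sin(ax)/x dx = (π/2) sign a`, p0161:L49) to eq. 21; with `integral_sinc_sq_Ioi` it gives a second,
  Fubini-free proof of Dirichlet's integral.
-/

noncomputable section

open Real MeasureTheory Set Filter intervalIntegral
open scoped Topology

namespace Literature.Analysis.Fourier

/-- `sinc²` is integrable on `ℝ` (part of `∫₀^∞ sin²x/x² dx = π/2`). [cite: Jeffrey1995, §15.2.1 eq. 21 (p0161:L73)] -/
theorem integrable_sinc_sq_real : Integrable fun x : ℝ ↦ Real.sinc x ^ 2 := by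
  have h := integrable_sinc_sq.comp_mul_left' (inv_ne_zero Real.pi_ne_zero)
  have e : (fun x : ℝ ↦ Real.sinc (π * (π⁻¹ * x)) ^ 2) = fun x ↦ Real.sinc x ^ 2 := by
    funext x; rw [← mul_assoc, mul_inv_cancel₀ Real.pi_ne_zero, one_mul]
  rw [← e]
  exact h

/-- **`∫_ℝ sinc(x)² dx = π`** (rescaling of the tree's `∫ sinc(πx)² dx = 1`; twice `∫₀^∞ sin²x/x² dx = π/2`).
[cite: Jeffrey1995, §15.2.1 eq. 21 (p0161:L73)] -/
theorem integral_sinc_sq_eq_pi : ∫ x : ℝ, Real.sinc x ^ 2 = π := by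
  have h := integral_sinc_sq
  have h2 : ∫ x : ℝ, Real.sinc (π * x) ^ 2 = |π⁻¹| • ∫ x : ℝ, Real.sinc x ^ 2 :=
    Measure.integral_comp_mul_left (fun x : ℝ ↦ Real.sinc x ^ 2) π
  rw [h, abs_of_pos (inv_pos.2 Real.pi_pos), smul_eq_mul] at h2
  have h3 := congrArg (fun t : ℝ ↦ π * t) h2
  rw [mul_one, ← mul_assoc, mul_inv_cancel₀ Real.pi_ne_zero, one_mul] at h3
  exact h3.symm

/-- **`∫₀^∞ sin²x/x² dx = π/2`**. [cite: Jeffrey1995, §15.2.1 eq. 21 (p0161:L73)] -/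
theorem integral_sinc_sq_Ioi : ∫ x in Ioi (0 : ℝ), Real.sinc x ^ 2 = π / 2 := by
  have h := integral_eq_integral_Ioi_add_neg integrable_sinc_sq_real
  rw [integral_sinc_sq_eq_pi] at h
  have h2 : ∫ x in Ioi (0 : ℝ), (Real.sinc x ^ 2 + Real.sinc (-x) ^ 2) =
      2 * ∫ x in Ioi (0 : ℝ), Real.sinc x ^ 2 := by
    rw [← MeasureTheory.integral_const_mul]
    refine setIntegral_congr_fun measurableSet_Ioi fun x _ ↦ ?_
    rw [Real.sinc_neg]; ring
  rw [h2] at h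
  linarith


/-! ## Integration by parts: `∫₀^{2T} sinc = ∫₀^T sinc² + sin T · sinc T` -/

/-- `d/dx (sin x · sinc x) = 2 sinc(2x) − sinc(x)²` for `x ≠ 0` (i.e. `(sin²x/x)′ = sin 2x/x − sin²x/x²`).
[folklore] -/
private theorem hasDerivAt_sin_mul_sinc {x : ℝ} (hx : x ≠ 0) :
    HasDerivAt (fun y : ℝ ↦ Real.sin y * Real.sinc y) (2 * Real.sinc (2 * x) - Real.sinc x ^ 2) x := by
  have h1 : HasDerivAt (fun y : ℝ ↦ Real.sin y ^ 2 / y)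
      ((2 * Real.sin x ^ (2 - 1) * Real.cos x * x - Real.sin x ^ 2 * 1) / x ^ 2) x :=
    ((Real.hasDerivAt_sin x).pow 2).div (hasDerivAt_id x) hx
  have heq : (fun y : ℝ ↦ Real.sin y ^ 2 / y) =ᶠ[𝓝 x] fun y ↦ Real.sin y * Real.sinc y := by
    filter_upwards [isOpen_ne.mem_nhds hx] with y hy
    rw [Real.sinc_of_ne_zero hy]
    field_simp
  have h2 := h1.congr_of_eventuallyEq heq.symm
  refine h2.congr_deriv ?_
  have h2x : (2 : ℝ) * x ≠ 0 := mul_ne_zero two_ne_zero hx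
  rw [Real.sinc_of_ne_zero h2x, Real.sinc_of_ne_zero hx, Real.sin_two_mul]
  field_simp
  ring

/-- **`∫₀^{2T} sinc = ∫₀^T sinc(x)² dx + sin T · sinc T`** for `T ≥ 0` — the integration by parts linking the
two table integrals `∫₀^∞ sin(2x)/x dx` and `∫₀^∞ sin²x/x² dx` (at `T = 0` both sides vanish).
[cite: Jeffrey1995, §15.2.1 eqs. 13 and 21 (p0161:L49, L73)] -/
theorem intervalIntegral_sinc_two_mul_eq {T : ℝ} (hT : 0 ≤ T) :
    ∫ x in (0 : ℝ)..(2 * T), Real.sinc x = (∫ x in (0 : ℝ)..T, Real.sinc x ^ 2) + Real.sin T * Real.sinc T := by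
  have hcont : Continuous fun y : ℝ ↦ Real.sin y * Real.sinc y :=
    Real.continuous_sin.mul Real.continuous_sinc
  have hder : ∀ x ∈ Ioo (0 : ℝ) T,
      HasDerivAt (fun y : ℝ ↦ Real.sin y * Real.sinc y) (2 * Real.sinc (2 * x) - Real.sinc x ^ 2) x :=
    fun x hx ↦ hasDerivAt_sin_mul_sinc hx.1.ne'
  have hc2 : Continuous fun x : ℝ ↦ 2 * Real.sinc (2 * x) - Real.sinc x ^ 2 :=
    (continuous_const.mul (Real.continuous_sinc.comp (continuous_const.mul continuous_id))).sub
      (Real.continuous_sinc.pow 2)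
  have hftc := integral_eq_sub_of_hasDerivAt_of_le hT hcont.continuousOn hder
    (hc2.intervalIntegrable 0 T)
  simp only [Real.sin_zero, zero_mul, sub_zero] at hftc
  have hsplit : ∫ x in (0 : ℝ)..T, (2 * Real.sinc (2 * x) - Real.sinc x ^ 2) =
      (∫ x in (0 : ℝ)..T, 2 * Real.sinc (2 * x)) - ∫ x in (0 : ℝ)..T, Real.sinc x ^ 2 :=
    integral_sub ((continuous_const.mul (Real.continuous_sinc.comp
      (continuous_const.mul continuous_id))).intervalIntegrable 0 T)
      ((Real.continuous_sinc.pow 2).intervalIntegrable 0 T)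
  have hscale : ∫ x in (0 : ℝ)..T, 2 * Real.sinc (2 * x) = ∫ x in (0 : ℝ)..(2 * T), Real.sinc x := by
    rw [intervalIntegral.integral_const_mul, intervalIntegral.integral_comp_mul_left _ two_ne_zero,
      mul_zero, smul_eq_mul]
    field_simp
  rw [hsplit, hscale] at hftc
  linarith

/-- `∫₀^T sin²x/x² dx → π/2` as `T → ∞`. [cite: Jeffrey1995, §15.2.1 eq. 21 (p0161:L73)] -/
theorem tendsto_intervalIntegral_sinc_sq_atTop :
    Tendsto (fun T : ℝ ↦ ∫ x in (0 : ℝ)..T, Real.sinc x ^ 2) atTop (𝓝 (π / 2)) := by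
  rw [← integral_sinc_sq_Ioi]
  exact intervalIntegral_tendsto_integral_Ioi 0 integrable_sinc_sq_real.integrableOn tendsto_id

end Literature.Analysis.Fourier

end
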